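import Summits.AtomisticToContinuum.Crystallization.Theses.ReggeStarCoercivity
import Summits.AtomisticToContinuum.Crystallization.Theorems.ChargedEnergyGap.Negative.BlocksLocal
import Summits.AtomisticToContinuum.Crystallization.Theorems.ReggeStarCoercivityPeriodicStarCoercivityDefs
import Summits.AtomisticToContinuum.Crystallization.Theorems.ReggeStarCoercivityPeriodicStarCoercivityCollarCount

/-!
# `StarCoercivity → PeriodicStarCoercivity` (13600 ⇒ 13602) by trial blocks

Route `ReggeStarCoercivity` (sub-problem `Crystallization` of `AtomisticToContinuum`). The route files the torus
twin `PeriodicStarCoercivity` (item stmt-AtomisticToContinuum-13602) with `deps: StarCoercivity` (item 13600, the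
thesis X). This file lands that dependency edge as a tree theorem,
`periodicStarCoercivity_of_starCoercivity : StarCoercivity → PeriodicStarCoercivity` (SAME constant `g`), so that a
proof of 13600 closes 13602 by modus ponens; together with the landed converse
`StarCoercivityPeriodisation.starCoercivity_of_periodicStarCoercivity` (periodisation) the two cruxes are ONE statement
in the tree (`periodicStarCoercivity_iff_starCoercivity`). The argument is the trial-block argument of the standing
adversary file `Cruxes/StarCoercivity/Disproof.lean` §12 (cdisprove g3, kernel-checked there; `Cruxes/` is not importable
from `Theorems/`), re-proved here on top of the LANDED block infrastructure `ChargedEnergyGap.Negative.Blocks*`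
instead of from scratch.

PROOF. Fix `g, C` from `StarCoercivity` and a periodic `P` with motif size `m` and `D` defective motif points. For
`K ≥ 1` let `x_K = Blocks.blockConfig P K` be the block `F + {Σ kᵢbᵢ : 0 ≤ kᵢ < K}` (`N = m K³` distinct points of
`P.points`). (i) ENERGY (landed, `Blocks.exists_block_energy_le`): `E_LJ(x_K) ≤ N (e(P) + ε)` for `K ≥ K₀(ε)`.
(ii) SHELLS (`block_shell_eq`): at a block point whose lattice coordinates are `depth P 2`-deep, every point of
`P.points` within distance `< 2` is a block point (`Blocks.exists_eq_toP_of_dist_lt`), so the recentred `6/5`-shell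
read in the finite configuration `x_K` IS the shell read in `P.points`; hence such a block point is defective in
`x_K` iff its motif representative is defective in `P` (`block_isDefective_iff`, lattice invariance `isFree_add_iff`).
(iii) COUNTING (`card_defects_block_ge`): at most `6 d K²` coordinate triples are not `d`-deep
(`Blocks.card_not_deep_le`), so `#Def(x_K) ≥ D (K³ − 6 d K²)`. (iv) Feeding `x_K` to `StarCoercivity` and using
`N^{2/3} ≤ N/K` (`rpow_two_thirds_le`): `m K³ e_per + g D (K³ − 6dK²) − max(C,0) m K² ≤ m K³ (e(P) + ε)`; divide by
`m K³` and let `K → ∞`, `ε → 0`: `e_per + g D/m ≤ e(P)`, which is the body `PSCAt g P` of the crux (`Iff.rfl`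
against the landed Defs module).
-/

noncomputable section

namespace Summit.AtomisticToContinuum.Crystallization.Theorems.ReggeStarCoercivityPeriodicStarCoercivity

open scoped BigOperators
open Literature.MathematicalPhysics.StatisticalMechanics Literature.Geometry.DiscreteGeometry
open Summit.AtomisticToContinuum.Crystallization.Theorems.ChargedEnergyGapNegative
open Summit.AtomisticToContinuum.Crystallization.Theses.ReggeStarCoercivity (StarCoercivity PeriodicStarCoercivity)

variable (P : PeriodicConfiguration 3) (K : ℕ)

/-! ## Shells of deep block points -/

/-- **Shell transfer.** At a block point of `x_K = Blocks.blockConfig P K` whose lattice coordinates are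
`depth P 2`-deep, the recentred `6/5`-shell read in the finite block (the sub-term of `StarCoercivity`) equals the
shell read in `P.points` (the sub-term `shell` of `PeriodicStarCoercivity`), for every rescaling `r`. -/
theorem block_shell_eq {a : Fin (Fintype.card (Blocks.BIdx P K))}
    (hdeep : Blocks.IsDeep K (Blocks.depth P 2) ((Fintype.equivFin (Blocks.BIdx P K)).symm a).2) (r : ℝ) :
    ((Finset.univ.filter fun j : Fin (Fintype.card (Blocks.BIdx P K)) =>
        j ≠ a ∧ dist (Blocks.blockConfig P K a) (Blocks.blockConfig P K j) ≤ 6 / 5).image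
        fun j => r⁻¹ • (Blocks.blockConfig P K j - Blocks.blockConfig P K a)) =
      shell P (Blocks.blockConfig P K a) r := by
  classical
  set e := Fintype.equivFin (Blocks.BIdx P K) with he
  have hxa : ∀ b, Blocks.blockConfig P K b = Blocks.bpt P K (e.symm b) := fun b => rfl
  ext z
  simp only [shell, Finset.mem_image, Finset.mem_filter, Finset.mem_univ, true_and,
    Set.Finite.mem_toFinset, Set.mem_inter_iff, Set.mem_sdiff, Metric.mem_closedBall,
    Set.mem_singleton_iff]
  constructor
  · rintro ⟨j, ⟨hja, hd⟩, rfl⟩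
    refine ⟨Blocks.blockConfig P K j, ⟨⟨?_, ?_⟩, ?_⟩, rfl⟩
    · rwa [dist_comm]
    · exact fun h => hja (Blocks.blockConfig_injective P K h)
    · rw [hxa]; exact Blocks.bpt_mem P K _
  · rintro ⟨y, ⟨⟨hd, hya⟩, hy⟩, rfl⟩
    have hne : (⟨y, hy⟩ : P.points) ≠ Blocks.toP P K (e.symm a) := by
      intro h
      apply hya
      have := congrArg Subtype.val h
      simpa [hxa] using this
    have hlt : dist (Blocks.bpt P K (e.symm a)) y < 2 := by
      rw [← hxa, dist_comm]
      linarith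
    obtain ⟨v, hv, hvq⟩ := Blocks.exists_eq_toP_of_dist_lt P K hdeep ⟨y, hy⟩ hne hlt
    have hvy : Blocks.bpt P K v = y := by
      have := congrArg Subtype.val hvq
      simpa using this
    have hxv : Blocks.blockConfig P K (e v) = y := by rw [hxa (e v)]; simpa using hvy
    refine ⟨e v, ⟨?_, ?_⟩, ?_⟩
    · intro h
      apply hv
      have := congrArg e.symm h
      simpa using this
    · rw [hxv, dist_comm]; exact hd
    · rw [hxv]

/-- **Status transfer.** A `depth P 2`-deep block point is defective in the finite block `x_K` (the predicate
counted by `StarCoercivity`) iff its motif representative is defective in `P` (the predicate counted by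
`PeriodicStarCoercivity`, `¬ IsFree`): shells agree (`block_shell_eq`) and statuses are invariant under the
lattice of periods (`isFree_add_iff`). -/
theorem block_isDefective_iff {a : Fin (Fintype.card (Blocks.BIdx P K))}
    (hdeep : Blocks.IsDeep K (Blocks.depth P 2) ((Fintype.equivFin (Blocks.BIdx P K)).symm a).2) :
    (¬ ∃ r : ℝ, 9 / 10 ≤ r ∧ r ≤ 11 / 10 ∧
        (ShellCloseTo (1 / 20) ((Finset.univ.filter fun j : Fin (Fintype.card (Blocks.BIdx P K)) =>
            j ≠ a ∧ dist (Blocks.blockConfig P K a) (Blocks.blockConfig P K j) ≤ 6 / 5).image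
            fun j => r⁻¹ • (Blocks.blockConfig P K j - Blocks.blockConfig P K a)) fccKissingPattern ∨
          ShellCloseTo (1 / 20) ((Finset.univ.filter fun j : Fin (Fintype.card (Blocks.BIdx P K)) =>
            j ≠ a ∧ dist (Blocks.blockConfig P K a) (Blocks.blockConfig P K j) ≤ 6 / 5).image
            fun j => r⁻¹ • (Blocks.blockConfig P K j - Blocks.blockConfig P K a)) hcpKissingPattern)) ↔
      ¬ IsFree P (((Fintype.equivFin (Blocks.BIdx P K)).symm a).1 : EuclideanSpace ℝ (Fin 3)) := by
  rw [not_iff_not]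
  simp_rw [block_shell_eq P K hdeep]
  have hxa : Blocks.blockConfig P K a =
      (((Fintype.equivFin (Blocks.BIdx P K)).symm a).1 : EuclideanSpace ℝ (Fin 3)) +
        Blocks.latVec P (Blocks.coords K ((Fintype.equivFin (Blocks.BIdx P K)).symm a).2) := rfl
  rw [hxa]
  exact isFree_add_iff P (Blocks.latVec_mem P _) _

/-! ## Counting defective block points -/

/-- **Counting.** The block `x_K` has at least `#def(P) · (K³ − 6·depth·K²)` defective sites: every pair
(defective motif point, deep coordinate triple) gives a distinct defective block index (`block_isDefective_iff`),
and at most `6·depth·K²` coordinate triples are not deep (`Blocks.card_not_deep_le`). -/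
theorem card_defects_block_ge :
    ((defectSet P).card : ℝ) * ((K : ℝ) ^ 3 - 6 * (Blocks.depth P 2 : ℝ) * (K : ℝ) ^ 2) ≤
      (Nat.card {i : Fin (Fintype.card (Blocks.BIdx P K)) // ¬ ∃ r : ℝ, 9 / 10 ≤ r ∧ r ≤ 11 / 10 ∧
        (ShellCloseTo (1 / 20) ((Finset.univ.filter fun j : Fin (Fintype.card (Blocks.BIdx P K)) =>
            j ≠ i ∧ dist (Blocks.blockConfig P K i) (Blocks.blockConfig P K j) ≤ 6 / 5).image
            fun j => r⁻¹ • (Blocks.blockConfig P K j - Blocks.blockConfig P K i)) fccKissingPattern ∨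
          ShellCloseTo (1 / 20) ((Finset.univ.filter fun j : Fin (Fintype.card (Blocks.BIdx P K)) =>
            j ≠ i ∧ dist (Blocks.blockConfig P K i) (Blocks.blockConfig P K j) ≤ 6 / 5).image
            fun j => r⁻¹ • (Blocks.blockConfig P K j - Blocks.blockConfig P K i)) hcpKissingPattern)} : ℝ) := by
  classical
  set e := Fintype.equivFin (Blocks.BIdx P K) with he
  set d : ℕ := Blocks.depth P 2 with hd
  -- the defect predicate of the block, as a predicate on indices
  set Df : Fin (Fintype.card (Blocks.BIdx P K)) → Prop := fun i => ¬ ∃ r : ℝ, 9 / 10 ≤ r ∧ r ≤ 11 / 10 ∧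
        (ShellCloseTo (1 / 20) ((Finset.univ.filter fun j : Fin (Fintype.card (Blocks.BIdx P K)) =>
            j ≠ i ∧ dist (Blocks.blockConfig P K i) (Blocks.blockConfig P K j) ≤ 6 / 5).image
            fun j => r⁻¹ • (Blocks.blockConfig P K j - Blocks.blockConfig P K i)) fccKissingPattern ∨
          ShellCloseTo (1 / 20) ((Finset.univ.filter fun j : Fin (Fintype.card (Blocks.BIdx P K)) =>
            j ≠ i ∧ dist (Blocks.blockConfig P K i) (Blocks.blockConfig P K j) ≤ 6 / 5).image
            fun j => r⁻¹ • (Blocks.blockConfig P K j - Blocks.blockConfig P K i)) hcpKissingPattern)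
    with hDf
  set S : Finset (Fin (Fintype.card (Blocks.BIdx P K))) := Finset.univ.filter fun i => Df i with hS
  have hcardS : Nat.card {i : Fin (Fintype.card (Blocks.BIdx P K)) // Df i} = S.card := by
    rw [Nat.card_eq_fintype_card, Fintype.card_subtype]
  set Deep : Finset (Fin 3 → Fin K) := Finset.univ.filter fun k => Blocks.IsDeep K d k with hDeep
  -- (1) the injection (defective motif point, deep coordinates) ↦ block index
  have hinj : ((defectSet P).attach ×ˢ Deep).card ≤ S.card := by
    refine Finset.card_le_card_of_injOn
      (fun p => e (⟨p.1.1, (Finset.mem_filter.1 p.1.2).1⟩, p.2)) (fun p hp => ?_) ?_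
    · -- lands in `S`
      have hp' := Finset.mem_product.1 hp
      have hk : Blocks.IsDeep K d p.2 := (Finset.mem_filter.1 hp'.2).2
      have hdef : ¬ IsFree P p.1.1 := (Finset.mem_filter.1 p.1.2).2
      rw [Finset.mem_coe, hS, Finset.mem_filter]
      refine ⟨Finset.mem_univ _, ?_⟩
      have hsymm : e.symm (e (⟨p.1.1, (Finset.mem_filter.1 p.1.2).1⟩, p.2)) =
          (⟨p.1.1, (Finset.mem_filter.1 p.1.2).1⟩, p.2) := e.symm_apply_apply _
      have hdeep' : Blocks.IsDeep K (Blocks.depth P 2)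
          (e.symm (e (⟨p.1.1, (Finset.mem_filter.1 p.1.2).1⟩, p.2))).2 := by
        rw [hsymm]; exact hk
      have key := block_isDefective_iff P K hdeep'
      rw [hsymm] at key
      exact key.2 hdef
    · -- injective
      intro p hp q hq hpq
      obtain ⟨h1, h2⟩ := Prod.mk.inj (e.injective hpq)
      have h11 : p.1.1 = q.1.1 := by simpa using congrArg Subtype.val h1
      exact Prod.ext (Subtype.ext h11) h2
  -- (2) the number of deep coordinate triples
  have hDeepCard : (K : ℝ) ^ 3 - 6 * (d : ℝ) * (K : ℝ) ^ 2 ≤ (Deep.card : ℝ) := by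
    have hsplit := Finset.card_filter_add_card_filter_not
      (s := (Finset.univ : Finset (Fin 3 → Fin K))) (fun k => Blocks.IsDeep K d k)
    have huniv : (Finset.univ : Finset (Fin 3 → Fin K)).card = K ^ 3 := by
      rw [Finset.card_univ, Fintype.card_fun, Fintype.card_fin, Fintype.card_fin]
    have hnot : (Finset.univ.filter fun k : Fin 3 → Fin K => ¬ Blocks.IsDeep K d k).card ≤ 6 * d * K ^ 2 := by
      convert Blocks.card_not_deep_le K d
    rw [huniv] at hsplit
    have h1 : (Deep.card : ℝ) + ((Finset.univ.filter fun k : Fin 3 → Fin K => ¬ Blocks.IsDeep K d k).card : ℝ)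
        = (K : ℝ) ^ 3 := by
      rw [hDeep]; exact_mod_cast hsplit
    have h2 : ((Finset.univ.filter fun k : Fin 3 → Fin K => ¬ Blocks.IsDeep K d k).card : ℝ) ≤
        6 * (d : ℝ) * (K : ℝ) ^ 2 := by exact_mod_cast hnot
    linarith
  -- (3) assemble
  have hprod : (((defectSet P).attach ×ˢ Deep).card : ℝ) = ((defectSet P).card : ℝ) * (Deep.card : ℝ) := by
    rw [Finset.card_product, Finset.card_attach, Nat.cast_mul]
  have hD0 : (0 : ℝ) ≤ ((defectSet P).card : ℝ) := Nat.cast_nonneg _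
  have hinj' : ((defectSet P).card : ℝ) * (Deep.card : ℝ) ≤ (S.card : ℝ) := by
    rw [← hprod]; exact_mod_cast hinj
  have hN : (Nat.card {i : Fin (Fintype.card (Blocks.BIdx P K)) // Df i} : ℝ) = (S.card : ℝ) := by
    exact_mod_cast hcardS
  rw [hN]
  exact (mul_le_mul_of_nonneg_left hDeepCard hD0).trans hinj'

/-! ## The boundary allowance is `o(N)` on blocks -/

/-- `N^{2/3} ≤ N / K` for `N = m K³` with `m ≥ 1` (the `C·N^{2/3}` allowance of `StarCoercivity` is negligible on
large blocks). -/
theorem rpow_two_thirds_le {m k : ℝ} (hm : 1 ≤ m) (hk : 0 ≤ k) :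
    (m * k ^ 3) ^ (2 / 3 : ℝ) ≤ m * k ^ 2 := by
  have h0 : 0 ≤ m * k ^ 3 := by positivity
  have hcube : ((m * k ^ 3) ^ (2 / 3 : ℝ)) ^ (3 : ℕ) = (m * k ^ 3) ^ (2 : ℕ) := by
    rw [← Real.rpow_natCast ((m * k ^ 3) ^ (2 / 3 : ℝ)) 3, ← Real.rpow_mul h0,
      ← Real.rpow_natCast (m * k ^ 3) 2]
    norm_num
  by_contra hlt
  push Not at hlt
  have hpos : 0 ≤ m * k ^ 2 := by positivity
  have h3 : (m * k ^ 2) ^ (3 : ℕ) < ((m * k ^ 3) ^ (2 / 3 : ℝ)) ^ (3 : ℕ) :=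
    pow_lt_pow_left₀ hlt hpos (by norm_num)
  rw [hcube] at h3
  have hk6 : 0 ≤ k ^ 6 := by positivity
  have hexp : (m * k ^ 2) ^ (3 : ℕ) - (m * k ^ 3) ^ (2 : ℕ) = m ^ 2 * (m - 1) * k ^ 6 := by ring
  have hnn : 0 ≤ m ^ 2 * (m - 1) * k ^ 6 := by
    have : 0 ≤ m - 1 := by linarith
    positivity
  linarith

/-! ## The transfer -/

/-- **One block.** `StarCoercivity` with constants `g > 0`, `C` applied to the block `x_K` (`K ≥ 1`) of `P` gives
`m K³ · e_per + g · #def(P) · (K³ − 6 d K²) − max(C,0) · m K² ≤ E_LJ(x_K)`. -/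
theorem starCoercivity_block {g C : ℝ} (hg : 0 < g)
    (hSC : ∀ (N : ℕ) (x : Fin N → EuclideanSpace ℝ (Fin 3)), Function.Injective x →
      (N : ℝ) * (⨅ Q : PeriodicConfiguration 3, Q.energyPerParticle lennardJones) +
        g * (Nat.card {i : Fin N // ¬ ∃ a : ℝ, 9 / 10 ≤ a ∧ a ≤ 11 / 10 ∧
          (ShellCloseTo (1 / 20) ((Finset.univ.filter fun j : Fin N => j ≠ i ∧ dist (x i) (x j) ≤ 6 / 5).image
              fun j => a⁻¹ • (x j - x i)) fccKissingPattern ∨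
            ShellCloseTo (1 / 20) ((Finset.univ.filter fun j : Fin N => j ≠ i ∧ dist (x i) (x j) ≤ 6 / 5).image
              fun j => a⁻¹ • (x j - x i)) hcpKissingPattern)} : ℝ) -
        C * (N : ℝ) ^ (2 / 3 : ℝ) ≤ interactionEnergy lennardJones x) :
    (P.motif.card : ℝ) * (K : ℝ) ^ 3 * ePer +
        g * (((defectSet P).card : ℝ) * ((K : ℝ) ^ 3 - 6 * (Blocks.depth P 2 : ℝ) * (K : ℝ) ^ 2)) -
        max C 0 * ((P.motif.card : ℝ) * (K : ℝ) ^ 2) ≤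
      interactionEnergy lennardJones (Blocks.blockConfig P K) := by
  have h1 := hSC _ (Blocks.blockConfig P K) (Blocks.blockConfig_injective P K)
  have hePer : (⨅ Q : PeriodicConfiguration 3, Q.energyPerParticle lennardJones) = ePer := rfl
  rw [hePer] at h1
  have hN : ((Fintype.card (Blocks.BIdx P K) : ℕ) : ℝ) = (P.motif.card : ℝ) * (K : ℝ) ^ 3 := by
    rw [Blocks.card_BIdx]; push_cast; ring
  rw [hN] at h1
  have hm : (1 : ℝ) ≤ P.motif.card := by exact_mod_cast P.motif_nonempty.card_pos
  have hcount := mul_le_mul_of_nonneg_left (card_defects_block_ge P K) hg.le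
  have hrpow : ((P.motif.card : ℝ) * (K : ℝ) ^ 3) ^ (2 / 3 : ℝ) ≤ (P.motif.card : ℝ) * (K : ℝ) ^ 2 :=
    rpow_two_thirds_le hm (Nat.cast_nonneg K)
  have hr0 : 0 ≤ ((P.motif.card : ℝ) * (K : ℝ) ^ 3) ^ (2 / 3 : ℝ) := Real.rpow_nonneg (by positivity) _
  have hC : C * ((P.motif.card : ℝ) * (K : ℝ) ^ 3) ^ (2 / 3 : ℝ) ≤ max C 0 * ((P.motif.card : ℝ) * (K : ℝ) ^ 2) :=
    (mul_le_mul_of_nonneg_right (le_max_left C 0) hr0).trans (mul_le_mul_of_nonneg_left hrpow (le_max_right C 0))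
  linarith

/-- **`StarCoercivity → PeriodicStarCoercivity`** (items 13600 ⇒ 13602, same `g`): trial blocks of the periodic
configuration carry its defective motif fraction and its energy per particle up to `o(1)`; see the module
docstring. -/
theorem periodicStarCoercivity_of_starCoercivity (h : StarCoercivity) : PeriodicStarCoercivity := by
  classical
  obtain ⟨g, hg, C, hSC⟩ := h
  refine ⟨g, hg, fun P => ?_⟩
  change PSCAt g P
  unfold PSCAt
  rw [mul_div_assoc]
  set m : ℝ := (P.motif.card : ℝ) with hmdef
  have hm : 0 < m := by rw [hmdef]; exact_mod_cast P.motif_nonempty.card_pos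
  set D : ℝ := ((defectSet P).card : ℝ) with hDdef
  have hD0 : 0 ≤ D := Nat.cast_nonneg _
  have hDm : D ≤ m := by
    rw [hDdef, hmdef]
    exact_mod_cast Finset.card_le_card (show defectSet P ⊆ P.motif from Finset.filter_subset _ _)
  set d : ℝ := (Blocks.depth P 2 : ℝ) with hddef
  have hd0 : 0 ≤ d := Nat.cast_nonneg _
  set C' : ℝ := max C 0 with hC'def
  have hC'0 : 0 ≤ C' := le_max_right _ _
  refine le_of_forall_pos_lt_add fun ε hε => ?_
  -- block energy for `K ≥ K₀`, and `K` large enough for the two error terms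
  obtain ⟨K₀, hK₀, hK⟩ := Blocks.exists_block_energy_le P (show (0 : ℝ) < ε / 4 by positivity)
  obtain ⟨K₁, hK₁⟩ := exists_nat_gt (4 * (6 * d * g + C') / ε)
  obtain ⟨Kn, hKn0, hKn1⟩ : ∃ Kn : ℕ, K₀ ≤ Kn ∧ K₁ ≤ Kn := ⟨max K₀ K₁, le_max_left _ _, le_max_right _ _⟩
  have hKpos : 0 < Kn := lt_of_lt_of_le hK₀ hKn0
  set k : ℝ := (Kn : ℝ) with hkdef
  have hk : 0 < k := by rw [hkdef]; exact_mod_cast hKpos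
  have hk1 : 4 * (6 * d * g + C') / ε < k := hK₁.trans_le (by rw [hkdef]; exact_mod_cast hKn1)
  -- the two inequalities on the block `x_Kn`
  have hlow := starCoercivity_block P Kn hg hSC
  have hup := hK Kn hKn0
  have hN : ((Fintype.card (Blocks.BIdx P Kn) : ℕ) : ℝ) = m * k ^ 3 := by
    rw [Blocks.card_BIdx]; push_cast; rw [hmdef, hkdef]
  rw [hN] at hup
  have he : P.energyPerParticle lennardJones = e P := rfl
  rw [he] at hup
  -- combine: m k³ ePer + g D (k³ − 6 d k²) − C' m k² ≤ m k³ (e P + ε/4)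
  have hcomb : m * k ^ 3 * ePer + g * (D * (k ^ 3 - 6 * d * k ^ 2)) - C' * (m * k ^ 2) ≤
      m * k ^ 3 * (e P + ε / 4) := hlow.trans hup
  -- error terms: (6 d g D + C' m) / k ≤ m (6 d g + C') / k < m ε / 4
  have herr1 : 6 * d * g * D ≤ 6 * d * g * m := mul_le_mul_of_nonneg_left hDm (by positivity)
  have herr2 : (6 * d * g + C') < k * (ε / 4) := by
    have := (div_lt_iff₀ hε).1 hk1
    linarith
  -- divide `hcomb` by `k²` then by `k`, in the form of products
  have hk2 : 0 < k ^ 2 := by positivity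
  have hmain : k * (m * ePer + g * D) ≤ k * (m * e P + m * (ε / 4)) + (6 * d * g * D + C' * m) := by
    have : k ^ 2 * (k * (m * ePer + g * D)) ≤ k ^ 2 * (k * (m * e P + m * (ε / 4)) + (6 * d * g * D + C' * m)) := by
      nlinarith
    exact le_of_mul_le_mul_left this hk2
  have hmain2 : k * (m * ePer + g * D) < k * (m * e P + m * (ε / 2)) := by
    have h3 : 6 * d * g * D + C' * m ≤ m * (6 * d * g + C') := by nlinarith
    have h4 : m * (6 * d * g + C') < m * (k * (ε / 4)) := mul_lt_mul_of_pos_left herr2 hm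
    nlinarith
  have hmain3 : m * ePer + g * D < m * e P + m * (ε / 2) := lt_of_mul_lt_mul_left hmain2 hk.le
  -- divide by `m`
  have hfin : ePer + g * (D / m) < e P + ε / 2 := by
    have h1 : ePer + g * (D / m) = (m * ePer + g * D) / m := by field_simp
    have h2 : (e P + ε / 2) * m = m * e P + m * (ε / 2) := by ring
    rw [h1, div_lt_iff₀ hm, h2]
    exact hmain3
  linarith

end Summit.AtomisticToContinuum.Crystallization.Theorems.ReggeStarCoercivityPeriodicStarCoercivity

end
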